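import Summits.QuantumFields.YangMills.Theorems.AllWindowsColdBoxBoxHighLineStep2Defs
import Summits.QuantumFields.YangMills.Theorems.AllWindowsColdBoxBoxHighLineLaplaceSandwichPauliFlat

/-!
# T-S5.6 input (6c): two-sided bounds for the edge-chart Haar weight `chartHaarWeight H a = Π_e σ_{SU(2)}(‖a_e‖)`
# (STUB-PLAN-S5-STEP2 §5 T-S5.6 `SmallFieldInsideFP`, planner ym-idea-2 g18; LINE-19 S5 ⟨stmt-QuantumFields-24004⟩/⟨24335⟩, LINE-20 U5 ⟨24336⟩;
# objects from ✓`…Step2Defs` BY NAME)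

Width seat `ym-line-sfw-p2-w4` (prover-ym-line-sfw-p2-w4-g27-0).  The Haar factor of the Faddeev–Popov chart weight `fpChartWeight` is controlled on
small fields by the one-factor bounds of ✓4d / ✓4k-C (`LaplaceSandwich.exp_le_two_pi_sq_mul_sigmaSU2_le`: `e^{−t²/3−t⁴} ≤ 2π²σ(t) ≤ e^{−t²/3+t⁴}` for
`|t| ≤ 1`) and the global bound `σ ≤ (2π²)⁻¹` (✓`sigmaSU2_le_sigma0`):
* `chartHaarWeight_nonneg`, **`chartHaarWeight_le`** — `0 ≤ chartHaarWeight H a ≤ ((2π²)⁻¹)^{|LandauFree H|}` for every `a`;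
* **`chartHaarWeight_ge_of_smallField`** — on `smallField H t`, `0 ≤ t ≤ 1`: `((2π²)⁻¹)^{n} · e^{−n·(t²/3 + t⁴)} ≤ chartHaarWeight H a` (`n = |LandauFree H|`);
* **`chartHaarWeight_le_exp_mul_of_smallField`** — the (6c) RATIO: for `a ∈ smallField H t` (`0 ≤ t ≤ 1`) and ANY `a′`,
  `chartHaarWeight H a′ ≤ e^{n·(t²/3 + t⁴)} · chartHaarWeight H a` (in T-S5.6: `t ≍ r`, `n ≍ 48H⁴`, so the factor is `e^{O(r²H⁴)} ≤ e^{O(rH⁵)}`).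

Everything proved; no definitions; standard axioms.  HONEST LABEL: an S-sized input of the OPEN task T-S5.6 of STEP 2 of the XL stub S5 of a critic-PASSed
DRAFT line on the R2ξ″ cruxes; T-S5.6, S5, U5 and the items ⟨24004⟩ ⟨24335⟩ ⟨24336⟩ remain OPEN; no stub is closed by name, no crux, rung or summit is proved;
the Yang–Mills mass gap is NOT proved by this file.
-/

set_option autoImplicit false

open Real Finset
open Literature.MathematicalPhysics.QuantumFieldTheory.Balaban1983to89.B10Eq22Rescaling (sigmaSU2)

namespace Summit.QuantumFields.YangMills.Theorems.AllWindowsColdBoxBoxHighLine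

namespace ChartHaar

variable {H : ℕ}

/-- The chart Haar weight is non-negative. -/
theorem chartHaarWeight_nonneg (a : LandauFree H → E3) : 0 ≤ chartHaarWeight H a :=
  Finset.prod_nonneg fun e _ => LaplaceSandwich.sigmaSU2_nonneg ‖a e‖

/-- **Global upper bound**: `chartHaarWeight H a ≤ ((2π²)⁻¹)^{|LandauFree H|}`. -/
theorem chartHaarWeight_le (a : LandauFree H → E3) :
    chartHaarWeight H a ≤ (1 / (2 * Real.pi ^ 2)) ^ Fintype.card (LandauFree H) := by
  rw [chartHaarWeight, ← Finset.card_univ, ← Finset.prod_const]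
  exact Finset.prod_le_prod (fun e _ => LaplaceSandwich.sigmaSU2_nonneg ‖a e‖)
    fun e _ => Summit.QuantumFields.YangMills.BalabanUVNodes.N08HaarCompatibilityGuardCoerciveWindows.sigmaSU2_le_sigma0 ‖a e‖

/-- One factor on a small field: `(2π²)⁻¹ · e^{−(t²/3 + t⁴)} ≤ σ(‖v‖)` for `‖v‖ ≤ t ≤ 1`. -/
theorem sigmaSU2_norm_ge {v : E3} {t : ℝ} (ht1 : t ≤ 1) (hv : ‖v‖ ≤ t) :
    1 / (2 * Real.pi ^ 2) * Real.exp (-(t ^ 2 / 3 + t ^ 4)) ≤ sigmaSU2 ‖v‖ := by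
  have h0 : 0 ≤ ‖v‖ := norm_nonneg v
  have h1 : |‖v‖| ≤ 1 := by rw [abs_of_nonneg h0]; linarith
  have h := (LaplaceSandwich.exp_le_two_pi_sq_mul_sigmaSU2_le h1).1
  have hπ : 0 < 2 * Real.pi ^ 2 := by positivity
  have hmono : Real.exp (-(t ^ 2 / 3 + t ^ 4)) ≤ Real.exp (-(‖v‖ ^ 2 / 3) - ‖v‖ ^ 4) := by
    refine Real.exp_le_exp.2 ?_
    have h2 : ‖v‖ ^ 2 ≤ t ^ 2 := pow_le_pow_left₀ h0 hv 2
    have h4 : ‖v‖ ^ 4 ≤ t ^ 4 := pow_le_pow_left₀ h0 hv 4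
    linarith
  rw [div_mul_eq_mul_div, one_mul, div_le_iff₀ hπ]
  calc Real.exp (-(t ^ 2 / 3 + t ^ 4)) ≤ Real.exp (-(‖v‖ ^ 2 / 3) - ‖v‖ ^ 4) := hmono
    _ ≤ 2 * Real.pi ^ 2 * sigmaSU2 ‖v‖ := h
    _ = sigmaSU2 ‖v‖ * (2 * Real.pi ^ 2) := mul_comm _ _

/-- **Lower bound on small fields**: for `a ∈ smallField H t`, `0 ≤ t ≤ 1`,
`((2π²)⁻¹)^{n} · e^{−n(t²/3 + t⁴)} ≤ chartHaarWeight H a`, `n = |LandauFree H|`. -/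
theorem chartHaarWeight_ge_of_smallField {t : ℝ} (ht1 : t ≤ 1) {a : LandauFree H → E3} (ha : a ∈ smallField H t) :
    (1 / (2 * Real.pi ^ 2)) ^ Fintype.card (LandauFree H) * Real.exp (-(Fintype.card (LandauFree H) * (t ^ 2 / 3 + t ^ 4))) ≤
      chartHaarWeight H a := by
  have hfac : ∀ e : LandauFree H, 1 / (2 * Real.pi ^ 2) * Real.exp (-(t ^ 2 / 3 + t ^ 4)) ≤ sigmaSU2 ‖a e‖ :=
    fun e => sigmaSU2_norm_ge ht1 (ha e)
  have hnn : 0 ≤ 1 / (2 * Real.pi ^ 2) * Real.exp (-(t ^ 2 / 3 + t ^ 4)) := by positivity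
  calc (1 / (2 * Real.pi ^ 2)) ^ Fintype.card (LandauFree H) * Real.exp (-(Fintype.card (LandauFree H) * (t ^ 2 / 3 + t ^ 4)))
      = ∏ _e : LandauFree H, (1 / (2 * Real.pi ^ 2) * Real.exp (-(t ^ 2 / 3 + t ^ 4))) := by
        rw [Finset.prod_const, Finset.card_univ, mul_pow, ← Real.exp_nat_mul, neg_mul_eq_mul_neg]
    _ ≤ ∏ e : LandauFree H, sigmaSU2 ‖a e‖ := Finset.prod_le_prod (fun _ _ => hnn) fun e _ => hfac e
    _ = chartHaarWeight H a := rfl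

/-- **The (6c) ratio**: for `a ∈ smallField H t` (`0 ≤ t ≤ 1`) and any `a′`, `chartHaarWeight H a′ ≤ e^{n(t²/3 + t⁴)} · chartHaarWeight H a`. -/
theorem chartHaarWeight_le_exp_mul_of_smallField {t : ℝ} (ht1 : t ≤ 1) {a : LandauFree H → E3} (ha : a ∈ smallField H t)
    (a' : LandauFree H → E3) :
    chartHaarWeight H a' ≤ Real.exp (Fintype.card (LandauFree H) * (t ^ 2 / 3 + t ^ 4)) * chartHaarWeight H a := by
  have hup := chartHaarWeight_le a'
  have hlo := chartHaarWeight_ge_of_smallField ht1 ha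
  have hE : 0 < Real.exp (Fintype.card (LandauFree H) * (t ^ 2 / 3 + t ^ 4)) := Real.exp_pos _
  have hkey : (1 / (2 * Real.pi ^ 2)) ^ Fintype.card (LandauFree H) ≤
      Real.exp (Fintype.card (LandauFree H) * (t ^ 2 / 3 + t ^ 4)) * chartHaarWeight H a := by
    have h := mul_le_mul_of_nonneg_left hlo hE.le
    rw [← mul_assoc, mul_comm (Real.exp _) ((1 / (2 * Real.pi ^ 2)) ^ _), mul_assoc, ← Real.exp_add, add_neg_cancel,
      Real.exp_zero, mul_one] at h
    exact h
  exact hup.trans hkey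

end ChartHaar

end Summit.QuantumFields.YangMills.Theorems.AllWindowsColdBoxBoxHighLine
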